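import Summits.CriticalPhenomena.PercolationContinuityZ3.Theorems.Transplant.SkelPhiParaRunChain
import Summits.CriticalPhenomena.PercolationContinuityZ3.Theorems.Transplant.SkelPhiRootBridgeGeom
import HarnessLib

/-!
# N1 (the `{±1}` node), LEVEL 1 kit layer: THE BRIDGE → y′-RUN CROSS LINK WITH TWO SIGNS (hop side `σ_h` ≠ run sign `σ`)

Under (L-F1)'s cure (ii)/(iii) (lane INBOX 2026-08-22T01:09:22Z, 01:14:14Z, 01:39:09Z) the y′-face route keeps the run sign `σ = sgOf du`
(outward) but chooses the HOP SIDE `σ_h := σ·sgn⁺ v_α` by the sign of the split (the one unavoidable bookkeeping of the recession lemma):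
the bridge lives in its own frame `rootFrame φ c σ_h`, the y′-run in `runY φ c_L n h σ`, and the cross link "bridge core 1 ⊆ y′-run core 0"
(`faceRoute_of_bridge₃/₄`'s `hx₁₂`) must be read with the RELATIVE sign `s_h := σ·σ_h`.  `faceRoute_of_numbers5_y` (:307–:325) proves the
case `σ_h = σ` inline; this file serves both signs once:
* `runY_one_eq_rootFrame` / `runY_zero_eq_rootFrame` — the y′-run coordinates of a vertex from its bridge-frame coordinates
  (`runY w 1 = (σσ_h)·rf w 0 − σ·yL 0`, `runY w 0 = ⌊σ·(n·(rf w 1 − yL 1) − h·(σ_h·rf w 0 − yL 0))/U⌋`, origin `φ c_L = φ c + yL`, `yL` ABSOLUTE);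
* **`runY_core_zero_of_bridge_core`** — from the two cross-link fields in stmt-g15's convention ('B(σ_h)-frame, origin absolute, sign s_h'):
  `hxa : ∀ x ∈ Icc core1Lo core1Hi, −(n+v)⁺ ≤ (σσ_h)·x 0 − σ·yL 0 ≤ (n−v)⁺` and
  `hxb : ∀ x ∈ Icc core1Lo core1Hi, |σ·(n·(x 1 − yL 1) − h·(σ_h·x 0 − yL 0))| + U ≤ (q_B + 1)·U`
  ⟹ `rootFrame φ c σ_h w ∈ Icc core1Lo core1Hi → runY φ c_L n h σ w ∈ (yRunSched …).core 0`.
Pure bookkeeping; no probability.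

builds on p205010 (kernel theorem, internal audit signed; external expert review pending) — nothing in this file uses p205010; nothing here is a
claim about the open node `SamePDropOfSkeletonNeg`.
Lane `prim-bschramm`, seat `prim-bschramm-p1` (gen 13); helper file (`--supports stmt-CriticalPhenomena-4575 --as helper`).
[cite: KozmaNitzan2024, §4 Lemma 11 (pp. 22–23: consecutive target boxes), Lemma 12 (pp. 23–25)]
[cite: MartineauTassion2017, §4.3 Lemma 4.2 (arXiv:1312.1946 pp. 12–14)]
-/

noncomputable section

open scoped Classical

namespace Summit.CriticalPhenomena.PercolationContinuityZ3.Theorems.Transplant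

namespace Skelφ

open Literature.Probability.Percolation Literature.Probability.LatticeModels SimpleGraph
open ChainPlanar ChainPara

variable {V : Type} {φ : V → Site 2}

/-! ## §1 y′-run coordinates from bridge-frame coordinates -/

/-- **Transverse y′-coordinate from the bridge frame**: `runY φ c_L n h σ w 1 = (σ·σ_h)·rootFrame φ c σ_h w 0 − σ·yL 0` (`φ c_L = φ c + yL`,
`σ_h = ±1`). [folklore] -/
theorem runY_one_eq_rootFrame (c cL : V) {yL : Site 2} (hcL : φ cL = φ c + yL) (n : ℕ) (h σ : ℤ) {σh : ℤ} (hσh : σh = 1 ∨ σh = -1) (w : V) :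
    runY φ cL n h σ w 1 = σ * σh * rootFrame φ c σh w 0 - σ * yL 0 := by
  have hsq : σh * σh = 1 := by rcases hσh with rfl | rfl <;> simp
  rw [runY_one, relCoord_apply, rootFrame_apply_zero, hcL, Pi.add_apply]
  have e : σ * σh * (σh * (φ w 0 - φ c 0)) = σ * ((σh * σh) * (φ w 0 - φ c 0)) := by ring
  rw [e, hsq, one_mul]; ring

/-- **Along y′-coordinate from the bridge frame**: `runY φ c_L n h σ w 0 = ⌊σ·(n·(rf w 1 − yL 1) − h·(σ_h·rf w 0 − yL 0))/U⌋`. [folklore] -/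
theorem runY_zero_eq_rootFrame (c cL : V) {yL : Site 2} (hcL : φ cL = φ c + yL) (n : ℕ) (h σ : ℤ) {σh : ℤ} (hσh : σh = 1 ∨ σh = -1) (w : V) :
    runY φ cL n h σ w 0 =
      (σ * ((n : ℤ) * (rootFrame φ c σh w 1 - yL 1) - h * (σh * rootFrame φ c σh w 0 - yL 0))) / (shearUnit n h : ℤ) := by
  have hsq : σh * σh = 1 := by rcases hσh with rfl | rfl <;> simp
  rw [runY_zero, shearCoord_apply, rootFrame_apply_zero, rootFrame_apply_one, hcL, Pi.add_apply, Pi.add_apply]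
  congr 1
  have e : σh * (σh * (φ w 0 - φ c 0)) = (σh * σh) * (φ w 0 - φ c 0) := by ring
  rw [e, hsq, one_mul]; ring

/-! ## §2 The cross link with two signs -/

/-- **BRIDGE CORE 1 ⊆ y′-RUN CORE 0, two signs**: with the bridge in `rootFrame φ c σ_h`, the y′-run `yRunSched` (1 ≤ n, |v| ≤ n, layer
inequality) read in `runY φ c_L n h σ` from an origin `φ c_L = φ c + yL`, and the two cross-link readings of the bridge's core box
(`hxa`: the core's signed α-range sits inside window `0` `[−(n+v)⁺, (n−v)⁺]` about `σ·yL 0`; `hxb`: its sheared-height range within `q_B` windows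
of the origin), every vertex of the core window lies in the run's core `0`. [cite: KozmaNitzan2024, §4 Lemma 11 (pp. 22–23)] -/
theorem runY_core_zero_of_bridge_core {n ℓ : ℕ} {h v : ℤ} (hn : 1 ≤ n) (hv : |v| ≤ n) (hlay : (n + h.natAbs : ℕ) ≤ (n : ℤ) * ℓ + 1)
    (R' qB N : ℕ) (c cL : V) {yL : Site 2} (hcL : φ cL = φ c + yL) (σ : ℤ) {σh : ℤ} (hσh : σh = 1 ∨ σh = -1) {lo hi : Site 2}
    (hxa : ∀ x ∈ Finset.Icc lo hi,
      -((((n : ℤ) + v).toNat : ℕ) : ℤ) ≤ σ * σh * x 0 - σ * yL 0 ∧ σ * σh * x 0 - σ * yL 0 ≤ ((((n : ℤ) - v).toNat : ℕ) : ℤ))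
    (hxb : ∀ x ∈ Finset.Icc lo hi,
      |σ * ((n : ℤ) * (x 1 - yL 1) - h * (σh * x 0 - yL 0))| + shearUnit n h ≤ ((qB : ℤ) + 1) * shearUnit n h)
    {w : V} (hw : rootFrame φ c σh w ∈ Finset.Icc lo hi) :
    runY φ cL n h σ w ∈ (yRunSched hn hv hlay R' qB N).core 0 := by
  have hU0 : 0 < (shearUnit n h : ℤ) := shearUnit_pos hn h
  rw [yRunSched, mem_scheduleN_core_iff (yPrmW_ok hn hv hlay R' qB N) (yPrmW_eb n ℓ h v R' qB N), RunPrm.inCore_zero_iff,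
    runY_one_eq_rootFrame c cL hcL n h σ hσh w, runY_zero_eq_rootFrame c cL hcL n h σ hσh w]
  have ha := hxa _ hw
  have hb := hxb _ hw
  set sv := σ * ((n : ℤ) * (rootFrame φ c σh w 1 - yL 1) - h * (σh * rootFrame φ c σh w 0 - yL 0)) with hsv
  have hq : ((yPrmW n ℓ h v R' qB N).q : ℤ) = qB := rfl
  have hWm : ((yPrmW n ℓ h v R' qB N).Wm : ℤ) = ((((n : ℤ) + v).toNat : ℕ) : ℤ) := rfl
  have hWp : ((yPrmW n ℓ h v R' qB N).Wp : ℤ) = ((((n : ℤ) - v).toNat : ℕ) : ℤ) := rfl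
  rw [hq, hWm, hWp]
  have hsv' := abs_le.1 (show |sv| ≤ (qB : ℤ) * shearUnit n h by linarith only [hb, hU0])
  refine ⟨?_, ?_, ha.1, ha.2⟩
  · rw [Int.le_ediv_iff_mul_le hU0]
    linarith only [hsv'.1]
  · have hlt : sv / (shearUnit n h : ℤ) < (qB : ℤ) + 1 := by
      rw [Int.ediv_lt_iff_lt_mul hU0]
      have e : ((qB : ℤ) + 1) * (shearUnit n h : ℤ) = (qB : ℤ) * shearUnit n h + shearUnit n h := by ring
      rw [e]; linarith only [hsv'.2, hU0]
    exact Int.lt_add_one_iff.1 hlt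

/-- The same with the cross link asked only inside the kit ball (the literal shape of `faceRoute_of_bridge₃`'s `hx₁₂`). [folklore] -/
theorem runY_core_zero_of_bridge_core' {G : SimpleGraph V} {n ℓ : ℕ} {h v : ℤ} (hn : 1 ≤ n) (hv : |v| ≤ n)
    (hlay : (n + h.natAbs : ℕ) ≤ (n : ℤ) * ℓ + 1) (R' qB N : ℕ) (c cL : V) {yL : Site 2} (hcL : φ cL = φ c + yL) (σ : ℤ) {σh : ℤ}
    (hσh : σh = 1 ∨ σh = -1) {lo hi : Site 2} (L : ℕ)
    (hxa : ∀ x ∈ Finset.Icc lo hi,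
      -((((n : ℤ) + v).toNat : ℕ) : ℤ) ≤ σ * σh * x 0 - σ * yL 0 ∧ σ * σh * x 0 - σ * yL 0 ≤ ((((n : ℤ) - v).toNat : ℕ) : ℤ))
    (hxb : ∀ x ∈ Finset.Icc lo hi,
      |σ * ((n : ℤ) * (x 1 - yL 1) - h * (σh * x 0 - yL 0))| + shearUnit n h ≤ ((qB : ℤ) + 1) * shearUnit n h) :
    ∀ w ∈ Literature.Barriers.CriticalPhenomena.graphBall G c L, rootFrame φ c σh w ∈ Finset.Icc lo hi →
      runY φ cL n h σ w ∈ (yRunSched hn hv hlay R' qB N).core 0 :=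
  fun _ _ hw => runY_core_zero_of_bridge_core hn hv hlay R' qB N c cL hcL σ hσh hxa hxb hw

/-! ## §3 The origin of record and its window reading -/

/-- **The window reading of a core box from the ORIGIN OF RECORD** `σ·yL 0 = s_h·(c_lo + n) + v` (`s_h = σ·σ_h`; stmt-g15 / p1-g13, lane INBOX
2026-08-22T01:27Z–01:39Z): if the core's frame-α range is `[c_lo, c_hi]` with `c_hi − c_lo ≤ 2n` and `|v| ≤ n`, then every `x 0 ∈ [c_lo, c_hi]` reads
`−(n+v)⁺ ≤ s_h·x 0 − σ·yL 0 ≤ (n−v)⁺` — for BOTH relative signs `s_h = ±1`. [folklore] -/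
theorem window_reading_of_origin {n : ℕ} {v : ℤ} (hv : |v| ≤ n) {sh : ℤ} (hsh : sh = 1 ∨ sh = -1) {clo chi a x0 : ℤ}
    (horig : a = sh * (clo + n) + v) (hwid : chi - clo ≤ 2 * (n : ℤ)) (hx : clo ≤ x0 ∧ x0 ≤ chi) :
    -((((n : ℤ) + v).toNat : ℕ) : ℤ) ≤ sh * x0 - a ∧ sh * x0 - a ≤ ((((n : ℤ) - v).toNat : ℕ) : ℤ) := by
  rw [abs_le] at hv
  have h1 : ((((n : ℤ) + v).toNat : ℕ) : ℤ) = n + v := Int.toNat_of_nonneg (by linarith)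
  have h2 : ((((n : ℤ) - v).toNat : ℕ) : ℤ) = n - v := Int.toNat_of_nonneg (by linarith)
  rw [h1, h2, horig]
  rcases hsh with rfl | rfl
  · constructor <;> linarith
  · constructor <;> linarith

end Skelφ

end Summit.CriticalPhenomena.PercolationContinuityZ3.Theorems.Transplant

end
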